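import Mathlib
import Summits.MatrixMultiplication.MatrixMultiplication.Theses.FidelityWitnesses
import Summits.MatrixMultiplication.MatrixMultiplication.Theorems.FidelityWitnessesFidelityGapTwoSixExplicitFrames

/-!
# `FidelityWitnesses.FidelityGapTwoSixExplicit` (stmt-MatrixMultiplication-14041) — proved

`∀ S : P2 → P2 → P2 → ℂ, tensorRank S ≤ 6 → |Σ S·⟨2,2,2⟩|² ≤ (1 − 10⁻⁵)·8·Σ|S|²`: no tensor of rank `≤ 6`
in the `2 × 2` format has fidelity above `1 − 10⁻⁵` with the matrix multiplication tensor `⟨2,2,2⟩` — the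
first EFFECTIVE margin at the first border instance (the tree's `fidelityGapTwoSix_proof` is ineffective).

The proof is robust weak border apolarity with a STRUCTURAL certificate (no SOS, no Stiefel-manifold
minimisation); see the vocabulary file `FidelityWitnessesFidelityGapTwoSixExplicitDefs.lean` for the line
and the sibling files `…Kernel`, `…Gap`, `…Rows`, `…LemmaR`, `…FrameA`, `…FrameB`, `…LemmaA`, `…Symmetry`,
`…Sides`, `…Inputs`, `…Frames` for the steps.  In one paragraph: a violator `S` yields (tree theorem
`TensorApolarity.exists_subspace_of_algBorderRank_le`, CHL 2023 §2.3) a `10`-plane `F` of bilinear forms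
annihilating its slices with `dim F·A* ≤ 34`, `dim F·B* ≤ 34`, all of slice defect `≤ 8·10⁻⁵` against
`T`; the kernel of the `(210)`-symmetrisation on `F ⊗ A*` is then a `≥ 6`-plane within `√(1.6·10⁻⁴)` of
the explicit `8`-plane `Λ²U ⊗ S³V* ⊗ W*`; testing it against the missing `2`-plane `K ⊖ F` forces
(Lemma R: `kerProj = P_Y + P_E`, captured mass `4/3`, Bessel `≤ 1`) that plane within `1/√50` of a frame
`U ⊗ ĥ`; the `(120)` side, transported by the transpose symmetry of `⟨2,2,2⟩`, forces it within `1/√50` of a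
frame `σ(U ⊗ ĥ')`; and two such frames have cross Gram mass `≤ 1 < 2·(18/25)`.

This module imports the route file (its theorem's type is the route decl); every other step lives in
modules that do not.
-/

noncomputable section

namespace Summit.MatrixMultiplication.MatrixMultiplication.Theorems

/-! ## The theorem -/

open scoped BigOperators ComplexConjugate InnerProductSpace
open Literature.Computability.AlgebraicComplexity Module GapTwoSixExplicit

set_option linter.dupNamespace false in
/-- **`FidelityWitnesses.FidelityGapTwoSixExplicit`** (stmt-MatrixMultiplication-14041): no tensor of
rank `≤ 6` in the `2 × 2` format has fidelity above `1 − 10⁻⁵` with `⟨2,2,2⟩`: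
`|Σ S·⟨2,2,2⟩|² ≤ (1 − 10⁻⁵)·8·Σ|S|²`.  Proof: a violator yields (weak border apolarity for the honest
rank, tree theorem) a `10`-plane `F` of bilinear forms annihilating its slices with `dim F·A* ≤ 34`,
`dim F·B* ≤ 34`, whose elements have slice defect `≤ 8·10⁻⁵` against `T`; the A-side structure theorem
puts the missing plane `annT ⊓ perpTo F` within `1/√50` of a frame `U ⊗ ĥ`, the B-side within `1/√50`
of a frame `σ(U ⊗ ĥ')`, and the cross Gram bound `≤ 1` between any two such frames contradicts
`> 1`. [folklore] -/
theorem fidelityGapTwoSixExplicit_proof :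
    Summit.MatrixMultiplication.MatrixMultiplication.Theses.FidelityWitnesses.FidelityGapTwoSixExplicit := by
  intro S hS
  by_contra hlt
  rw [not_le] at hlt
  -- the ten-plane and its defect
  obtain ⟨F, hFS, hF10, hA, hB⟩ := exists_tenPlane hS
  have hθ : ∀ f ∈ F, (∑ c : P2, ‖∑ p : P2 × P2, f p * T2 c p.1 p.2‖ ^ 2)
      ≤ 8 * (1 / 100000) * ∑ p, ‖f p‖ ^ 2 :=
    fun f hf => defect_of_fidelity hlt (hFS hf)
  have hθ0 : (0 : ℝ) ≤ 8 * (1 / 100000) := by norm_num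
  have hθ1 : 8 * (1 / 100000) ≤ (1 : ℝ) / 10000 := by norm_num
  -- the two frames
  obtain ⟨ĥ, hĥ1, hAside⟩ := aside hF10 hA hθ hθ0 hθ1
  obtain ⟨ĥ', hĥ'1, hBside⟩ := bside hF10 hB hθ hθ0 hθ1
  -- the missing plane has dimension ≥ 2 and is close to both: contradiction
  have hL2 := two_le_finrank_missing hF10
  have h1 := one_lt_cross_of_near hL2 (orthonormal_uTensor hĥ1) (orthonormal_sigmaV_uTensor hĥ'1)
    hAside hBside
  have h2 := cross_gram_le ĥ ĥ'
  rw [hĥ1, hĥ'1] at h2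
  linarith

end Summit.MatrixMultiplication.MatrixMultiplication.Theorems

end
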